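import Literature.AlgebraicGeometry.Resolution.ExceptionalCurvePoints
import Literature.AlgebraicGeometry.Resolution.ExceptionalPointsFinite
import Literature.AlgebraicGeometry.Resolution.GermsOfClosedSubsets
import Literature.AlgebraicGeometry.Resolution.FiniteBirationalNormal
import Literature.AlgebraicGeometry.Morphisms.ZariskiConnectednessProper
import Mathlib.AlgebraicGeometry.FunctionField
import Mathlib.AlgebraicGeometry.Morphisms.SchemeTheoreticallyDominant
import HarnessLib

/-!
# The closed fibre of a resolution of a normal surface singularity is connected; every point of it
# lies on an exceptional curve

Topic: `Literature/AlgebraicGeometry/Resolution`. PROVED dictionary for the scheme-side vocabulary of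
surface singularities used with Lipman 1969 (`excCurvePoints`, Lipman's integral exceptional curves
`E_1, …, E_n`) and Artin–Verdier 1985 (`excPoints`, the maximal points of the closed fibre
"`C = ∪ C_i`"). Throughout, `T` is a Noetherian local NORMAL domain and `π : X → Spec T` a
resolution (`IsResolution`: proper, birational, `X` regular).

* `IsResolution.isIso_appTop` — **`H⁰(X, 𝒪_X) = T`**: `T → Γ(X, 𝒪_X)` is an isomorphism (`Γ(X, 𝒪_X)`
  is a finite `T`-algebra by EGA III 3.2.1, a domain inside `K(X) = Frac T`, and `T` is integrally
  closed; Lipman 1969, p. 199, "`H⁰(Z, 𝒪_Z) = R` since `R` is normal").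
* `IsResolution.isPreconnected_closedFibre` — **Zariski's connectedness theorem** for `π`: the closed
  fibre `π⁻¹(𝔪)` is connected (EGA III 4.3.1 / The Stacks Project Tag 03H0, from the tree's
  `ZariskiProper.preconnectedSpace_closedFibre`).
* `IsResolution.isRegularLocalRing_of_closedFibre_subsingleton` — if the closed fibre is a single
  point then `T` is regular (`X` is then affine and local, `π` finite birational onto the normal
  `Spec T`, hence an isomorphism).
* `IsResolution.exists_mem_excCurvePoints_specializes` — for `dim T = 2` and `T` SINGULAR: **every
  point of the closed fibre lies on an integral exceptional curve** (`∃ η ∈ excCurvePoints π, η ⤳ x`);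
  whence **purity** `excPoints π = excCurvePoints π` (the closed fibre has no isolated points; Lipman
  1969 §10 p. 212: "the components of `C` are in one-one correspondence with the (finitely many)
  non-closed points of `C`"), the converse dictionary `coheight x = 1 ⇒ x ∈ excCurvePoints π` for
  closed-fibre points, non-emptiness of `excCurvePoints π`, and (without the singularity
  hypothesis) `x ∈ excCurvePoints π ∨ {x}` closed for every closed-fibre point.

Everything is proved; no named facts. (Topological helpers — closed points of a proper `X` over a
local base, normality of the local rings of `Spec T` — are private.)

## References

* J. Lipman, *Rational singularities, with applications to algebraic surfaces and unique
  factorization*, Publ. Math. IHÉS 36 (1969), §1 (p. 199), §10 (p. 212), §12 (p. 220). [Lipman1969]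
* A. Grothendieck, J. Dieudonné, EGA III₁ (1961), Thm. 3.2.1, Thm. 4.3.1, Cor. 4.3.2. [EGAIII1]
* The Stacks Project, Tags 03H0, 0AY8, 0AB1. [StacksProject]
-/

noncomputable section

open CategoryTheory CategoryTheory.Limits AlgebraicGeometry TopologicalSpace Topology IsLocalRing
open Literature.AlgebraicGeometry.Morphisms

universe u

namespace Literature.AlgebraicGeometry.Resolution

/-! ## Local rings of `Spec` of a normal domain -/

/-- The local rings of `Spec T`, `T` a normal domain, are integrally closed (they are the
localisations `T_𝔭`). [folklore] -/
private theorem isIntegrallyClosed_stalk_Spec_of_isIntegrallyClosed (T : Type u) [CommRing T] [IsDomain T]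
    [IsIntegrallyClosed T] (y : Spec (.of T)) :
    IsIntegrallyClosed ((Spec (.of T)).presheaf.stalk y) := by
  letI : Algebra T ((Spec (.of T)).presheaf.stalk y) :=
    inferInstanceAs (Algebra T ((Spec.structureSheaf T).presheaf.stalk y))
  haveI : IsLocalization.AtPrime ((Spec (.of T)).presheaf.stalk y) y.asIdeal :=
    StructureSheaf.IsLocalization.to_stalk T y
  exact isIntegrallyClosed_of_isLocalization _ y.asIdeal.primeCompl
    (Ideal.primeCompl_le_nonZeroDivisors _)

section Resolution

variable {T : Type u} [CommRing T] [IsDomain T] [IsNoetherianRing T] [IsLocalRing T]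
  {X : Scheme.{u}} {π : X ⟶ Spec (.of T)}

/-! ## `H⁰(X, 𝒪_X) = T` -/

omit [IsLocalRing T] in
/-- **`H⁰(X, 𝒪_X) = T` for a resolution of a normal singularity**: for `T` a Noetherian normal
domain and `π : X → Spec T` proper birational with `X` regular (integral), the structure map
`T = Γ(Spec T, 𝒪) → Γ(X, 𝒪_X)` is an isomorphism. Indeed `Γ(X, 𝒪_X)` is finite over `T`
(EGA III 3.2.1, tree `finite_algebraMapΓ_of_isProper`), injects into `K(X)`, which birationality
identifies with `Frac T` over `T`; so every global function is integral over `T` inside `Frac T`,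
i.e. lies in `T`. [cite: Lipman1969, Section 1 (p. 199)] -/
theorem IsResolution.isIso_appTop [IsIntegrallyClosed T] (hπ : IsResolution π) :
    IsIso π.appTop := by
  haveI : IsProper π := hπ.isProper
  haveI : IsIntegral X := hπ.isIntegral_source
  haveI : IsDominant π := hπ.isBirational.isDominant
  haveI : IsSchemeTheoreticallyDominant π := .of_isDominant π
  haveI := hπ.isBirational.isIso_stalkMap_genericPoint
  have hπη : π (genericPoint X) = genericPoint (Spec (.of T)) := genericPoint_eq_of_isDominant π
  have hηV : genericPoint (Spec (.of T)) ∈ (⊤ : (Spec (.of T)).Opens) := trivial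
  have hξV : genericPoint X ∈ π ⁻¹ᵁ (⊤ : (Spec (.of T)).Opens) := trivial
  haveI : Nonempty ↥(⊤ : (Spec (.of T)).Opens) := ⟨⟨genericPoint (Spec (.of T)), trivial⟩⟩
  haveI : Nonempty ((⊤ : (Spec (.of T)).Opens) : Scheme.{u}) :=
    ⟨⟨genericPoint (Spec (.of T)), trivial⟩⟩
  haveI : Nonempty ↥(π ⁻¹ᵁ (⊤ : (Spec (.of T)).Opens)) := ⟨⟨_, hξV⟩⟩
  haveI : Nonempty ((π ⁻¹ᵁ (⊤ : (Spec (.of T)).Opens) : X.Opens) : Scheme.{u}) := ⟨⟨_, hξV⟩⟩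
  -- `A = Γ(Spec T, ⊤) → B = Γ(X, ⊤) → K(X)`
  letI algAB : Algebra Γ(Spec (.of T), ⊤) Γ(X, π ⁻¹ᵁ ⊤) := (π.app ⊤).hom.toAlgebra
  letI algAK : Algebra Γ(Spec (.of T), ⊤) X.functionField :=
    ((X.germToFunctionField (π ⁻¹ᵁ ⊤)).hom.comp (π.app ⊤).hom).toAlgebra
  haveI : IsScalarTower Γ(Spec (.of T), ⊤) Γ(X, π ⁻¹ᵁ ⊤) X.functionField :=
    IsScalarTower.of_algebraMap_eq (R := Γ(Spec (.of T), ⊤)) (S := Γ(X, π ⁻¹ᵁ ⊤))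
      (A := X.functionField) fun a => rfl
  -- `K(Y) ≅ K(X)` under `A`
  let e0 : (Spec (.of T)).presheaf.stalk (genericPoint (Spec (.of T))) ≅ X.functionField :=
    (Spec (.of T)).presheaf.stalkCongr (.of_eq hπη.symm) ≪≫ asIso (π.stalkMap (genericPoint X))
  have hsp : π (genericPoint X) ⤳ genericPoint (Spec (.of T)) := by rw [hπη]
  have he0 : ∀ a : Γ(Spec (.of T), ⊤), e0.hom ((Spec (.of T)).germToFunctionField ⊤ a) =
      X.germToFunctionField (π ⁻¹ᵁ ⊤) (π.app ⊤ a) := fun a => by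
    show ((Spec (.of T)).presheaf.germ ⊤ (genericPoint (Spec (.of T))) hηV ≫
      (Spec (.of T)).presheaf.stalkSpecializes hsp ≫ π.stalkMap (genericPoint X)) a =
        (π.app ⊤ ≫ X.presheaf.germ (π ⁻¹ᵁ ⊤) (genericPoint X) hξV) a
    rw [TopCat.Presheaf.germ_stalkSpecializes_assoc, Scheme.Hom.germ_stalkMap]
  let eA : (Spec (.of T)).functionField ≃ₐ[Γ(Spec (.of T), ⊤)] X.functionField :=
    { e0.commRingCatIsoToRingEquiv with
      commutes' := fun a => he0 a }
  haveI : IsFractionRing Γ(Spec (.of T), ⊤) (Spec (.of T)).functionField :=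
    functionField_isFractionRing_of_isAffineOpen (Spec (.of T)) ⊤ (isAffineOpen_top _)
  haveI : IsFractionRing Γ(Spec (.of T), ⊤) X.functionField :=
    IsLocalization.isLocalization_of_algEquiv (nonZeroDivisors Γ(Spec (.of T), ⊤)) eA
  -- `A` is integrally closed, `A → B` finite (hence integral) and injective, hence bijective
  haveI : IsIntegrallyClosed Γ(Spec (.of T), ⊤) :=
    isIntegrallyClosed_sections_of_stalk (isIntegrallyClosed_stalk_Spec_of_isIntegrallyClosed T)
      ⟨⊤, isAffineOpen_top _⟩
  have hfin : (π.app ⊤).hom.Finite := by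
    have h1 : (algebraMapΓ π).Finite := finite_algebraMapΓ_of_isProper π
    have h2 : ((algebraMapΓ π).comp (Scheme.ΓSpecIso (.of T)).hom.hom).Finite :=
      h1.comp
        (RingHom.Finite.of_surjective _ (Scheme.ΓSpecIso (.of T)).commRingCatIsoToRingEquiv.surjective)
    have h3 : (algebraMapΓ π).comp (Scheme.ΓSpecIso (.of T)).hom.hom = (π.app ⊤).hom := by
      rw [algebraMapΓ, RingHom.comp_assoc, ← CommRingCat.hom_comp, Iso.hom_inv_id,
        CommRingCat.hom_id, RingHom.comp_id]
      rfl
    rwa [h3] at h2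
  have hint : (π.app ⊤).hom.IsIntegral := RingHom.IsIntegral.of_finite hfin
  have hinj : Function.Injective (π.app ⊤) := π.app_injective ⊤
  have hsurj : Function.Surjective (π.app ⊤) := fun b => by
    have hb : IsIntegral Γ(Spec (.of T), ⊤) (algebraMap Γ(X, π ⁻¹ᵁ ⊤) X.functionField b) :=
      (show IsIntegral Γ(Spec (.of T), ⊤) b from hint b).map
        (IsScalarTower.toAlgHom Γ(Spec (.of T), ⊤) Γ(X, π ⁻¹ᵁ ⊤) X.functionField)
    obtain ⟨a, ha⟩ := IsIntegrallyClosed.algebraMap_eq_of_integral hb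
    refine ⟨a, X.germToFunctionField_injective (π ⁻¹ᵁ ⊤) ?_⟩
    rw [IsScalarTower.algebraMap_apply Γ(Spec (.of T), ⊤) Γ(X, π ⁻¹ᵁ ⊤) X.functionField] at ha
    exact ha
  exact (ConcreteCategory.isIso_iff_bijective _).mpr ⟨hinj, hsurj⟩

/-! ## Zariski's connectedness theorem for a resolution -/

/-- **The closed fibre of a resolution of a normal singularity is connected** (Zariski's
connectedness theorem, EGA III₁ Cor. 4.3.2; The Stacks Project, Tag 03H0): for `T` a Noetherian
local normal domain and `π : X → Spec T` a resolution, `π⁻¹(𝔪)` is preconnected. From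
`H⁰(X, 𝒪_X) = T` (`IsResolution.isIso_appTop`) and the tree's
`ZariskiProper.preconnectedSpace_closedFibre` (the scheme-theoretic closed fibre
`X ×_T Spec κ(𝔪)`, whose image in `X` is `π⁻¹(𝔪)`).
[cite: StacksProject, Tag 03H0 (More on Morphisms, Theorem 37.53.4)] -/
theorem IsResolution.isPreconnected_closedFibre [IsIntegrallyClosed T] (hπ : IsResolution π) :
    _root_.IsPreconnected (π.base ⁻¹' {closedPoint T}) := by
  haveI : IsProper π := hπ.isProper
  haveI : IsIso π.appTop := hπ.isIso_appTop
  let i : Spec (.of (ResidueField T)) ⟶ Spec (.of T) := Spec.map (CommRingCat.ofHom (residue T))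
  haveI : PreconnectedSpace ↥(pullback π i) := ZariskiProper.preconnectedSpace_closedFibre π
  have hi : Set.range (Spec.map (CommRingCat.ofHom (residue T))) = {closedPoint T} := by
    ext y
    constructor
    · rintro ⟨z, rfl⟩
      exact PrimeSpectrum.comap_residue T z
    · rintro rfl
      exact ⟨(⊥ : PrimeSpectrum (ResidueField T)), PrimeSpectrum.comap_residue T _⟩
  have hrange : Set.range (pullback.fst π i) = π.base ⁻¹' {closedPoint T} := by
    rw [Scheme.Pullback.range_fst]
    change π.base ⁻¹' Set.range (Spec.map (CommRingCat.ofHom (residue T))) = _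
    rw [hi]
  rw [← hrange]
  exact isPreconnected_range (pullback.fst π i).continuous

/-! ## Closed points; the case of a one-point closed fibre -/

omit [IsDomain T] [IsNoetherianRing T] in
/-- Over a local base, every point of a proper `X → Spec T` specialises to a closed point of `X`
lying in the closed fibre (`X` is quasi-compact and `T₀`; proper maps are closed, and the closed
point of `Spec T` is its only closed point). [folklore] -/
private theorem exists_isClosed_specializes_of_isProper [IsProper π] (x : X) :
    ∃ c : X, x ⤳ c ∧ IsClosed ({c} : Set X) ∧ π.base c = closedPoint T := by
  haveI : CompactSpace X := QuasiCompact.compactSpace_of_compactSpace π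
  obtain ⟨c, hc, hccl⟩ := (isClosed_closure (s := ({x} : Set X))).exists_closed_singleton
    ⟨x, subset_closure rfl⟩
  refine ⟨c, specializes_iff_mem_closure.mpr hc, hccl, ?_⟩
  have himg : IsClosed ({π.base c} : Set (Spec (.of T))) := by
    have := π.isClosedMap _ hccl
    rwa [Set.image_singleton] at this
  have hmax := (PrimeSpectrum.isClosed_singleton_iff_isMaximal (π.base c)).mp himg
  exact PrimeSpectrum.ext (IsLocalRing.eq_maximalIdeal hmax)

omit [IsNoetherianRing T] in
/-- **A resolution with a one-point closed fibre is an isomorphism; the singularity was regular.**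
For `T` a Noetherian local normal domain and `π : X → Spec T` a resolution whose closed fibre has
at most one point, `T` is a regular local ring. (Every point of `X` specialises into the closed
fibre `{η}`, so an affine neighbourhood of `η` is all of `X`; then `π` is affine and proper, i.e.
finite, and a finite birational morphism onto the normal `Spec T` is an isomorphism — tree
`isIso_of_isFinite_of_isBirational`, The Stacks Project Tag 0AB1 — so `T ≅ 𝒪_{X,η}` is regular.)
[cite: StacksProject, Tag 0AB1] -/
theorem IsResolution.isRegularLocalRing_of_closedFibre_subsingleton [IsIntegrallyClosed T]
    (hπ : IsResolution π) (hsub : (π.base ⁻¹' {closedPoint T}).Subsingleton) :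
    IsRegularLocalRing T := by
  haveI : IsProper π := hπ.isProper
  haveI : IsIntegral X := hπ.isIntegral_source
  -- a closed point `η` of `X`; it lies in the closed fibre, which is `{η}`
  obtain ⟨x₀⟩ := (inferInstance : Nonempty X)
  obtain ⟨η, -, -, hη⟩ := exists_isClosed_specializes_of_isProper (π := π) x₀
  have hall : ∀ x : X, x ⤳ η := fun x => by
    obtain ⟨c, hxc, -, hc⟩ := exists_isClosed_specializes_of_isProper (π := π) x
    have : c = η := hsub hc hη
    rwa [this] at hxc
  -- an affine open neighbourhood of `η` is everything: `X` is affine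
  obtain ⟨U, hU, hηU, -⟩ :=
    exists_isAffineOpen_mem_and_subset (X := X) (x := η) (U := ⊤) (Opens.mem_top _)
  have hUtop : U = ⊤ := by
    ext x
    simp only [Opens.coe_top, Set.mem_univ, iff_true]
    exact (hall x).mem_open U.isOpen hηU
  subst hUtop
  haveI : IsAffine (⊤ : X.Opens) := hU
  haveI : IsAffine X := IsAffine.of_isIso X.topIso.inv
  -- `π` is finite and birational onto the normal `Spec T`: an isomorphism
  haveI : IsAffineHom π := inferInstance
  haveI : IsFinite π := IsFinite.iff_isProper_and_isAffineHom.mpr ⟨inferInstance, inferInstance⟩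
  haveI : IsIso π :=
    isIso_of_isFinite_of_isBirational π (isIntegrallyClosed_stalk_Spec_of_isIntegrallyClosed T)
      hπ.isBirational
  -- `T ≅ 𝒪_{Spec T, 𝔪} ≅ 𝒪_{X, η}` is regular
  haveI : IsRegularLocalRing (X.presheaf.stalk η) := hπ.isRegular η
  have h1 : IsRegularLocalRing ((Spec (.of T)).presheaf.stalk (π.base η)) :=
    IsRegularLocalRing.of_ringEquiv (asIso (π.stalkMap η)).commRingCatIsoToRingEquiv.symm
  rw [hη] at h1
  letI : Algebra T ((Spec (.of T)).presheaf.stalk (closedPoint T)) :=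
    inferInstanceAs (Algebra T ((Spec.structureSheaf T).presheaf.stalk (closedPoint T)))
  haveI : IsLocalization.AtPrime ((Spec (.of T)).presheaf.stalk (closedPoint T))
      (closedPoint T).asIdeal :=
    StructureSheaf.IsLocalization.to_stalk T (closedPoint T)
  have hunits : (closedPoint T).asIdeal.primeCompl ≤ IsUnit.submonoid T := fun t ht => by
    have ht' : t ∉ maximalIdeal T := ht
    show IsUnit t
    simpa [IsLocalRing.mem_maximalIdeal, mem_nonunits_iff] using ht'
  let e : T ≃ₐ[T] (Spec (.of T)).presheaf.stalk (closedPoint T) :=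
    IsLocalization.atUnits (R := T) (M := (closedPoint T).asIdeal.primeCompl)
      (S := (Spec (.of T)).presheaf.stalk (closedPoint T)) hunits
  exact IsRegularLocalRing.of_ringEquiv e.toRingEquiv.symm

/-! ## Every point of the closed fibre lies on an exceptional curve -/

/-- In the specialisation preorder of a scheme (`x ≤ y ↔ y ⤳ x`), a proper specialisation is
strictly smaller (schemes are `T₀`). [folklore] -/
private theorem lt_of_specializes_of_ne' {x y : X} (h : y ⤳ x) (hne : x ≠ y) : x < y :=
  ⟨Scheme.le_iff_specializes.2 h, fun h' => hne ((Scheme.le_iff_specializes.1 h').antisymm h).eq⟩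

omit [IsDomain T] [IsNoetherianRing T] in
/-- The closed fibre of `π : X → Spec T` (`T` local) is closed. [folklore] -/
private theorem isClosed_closedFibre (π : X ⟶ Spec (.of T)) :
    IsClosed (π.base ⁻¹' {closedPoint T}) :=
  (isClosed_singleton_closedPoint T).preimage π.continuous

/-- **Every point of the closed fibre of a resolution of a normal surface SINGULARITY lies on an
integral exceptional curve**: for `T` a two-dimensional Noetherian local normal domain which is not
regular and `π : X → Spec T` a resolution, every `x` with `π x = 𝔪` has a generisation
`η ∈ excCurvePoints π` (`π η = 𝔪`, `dim closure {η} = 1`). Proof: a maximal point `η` of the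
closed fibre `E` above `x` exists; if `{η}` were closed, `{η}` and the union of the closures of the
other (finitely many) maximal points would disconnect `E` unless `E = {η}`, and then `T` would be
regular (`isRegularLocalRing_of_closedFibre_subsingleton`); so `{η}` is not closed and `η` is an
exceptional curve point (`IsResolution.mem_excCurvePoints_iff`). [cite: Lipman1969, Section 10 (p. 212)] -/
theorem IsResolution.exists_mem_excCurvePoints_specializes [IsIntegrallyClosed T]
    (h2 : ringKrullDim T = 2) (hπ : IsResolution π) (hsing : ¬ IsRegularLocalRing T)
    {x : X} (hx : π.base x = closedPoint T) :
    ∃ η ∈ excCurvePoints π, η ⤳ x := by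
  haveI : IsProper π := hπ.isProper
  set E : Set X := π.base ⁻¹' {closedPoint T} with hEdef
  have hE : IsClosed E := isClosed_closedFibre π
  obtain ⟨η, hηmax, hηx⟩ := exists_mem_maxPoints_specializes hE (show x ∈ E from hx)
  have hηexc : η ∈ excPoints π := hηmax
  by_cases hcl : IsClosed ({η} : Set X)
  swap
  · exact ⟨η, (hπ.mem_excCurvePoints_iff h2).2 ⟨hηexc, hcl⟩, hηx⟩
  exfalso
  apply hsing
  -- the other components of the closed fibre
  set F : Set X := ⋃ η' ∈ excPoints π \ {η}, closure {η'} with hFdef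
  have hF : IsClosed F :=
    ((excPoints_finite π).subset fun _ h => h.1).isClosed_biUnion fun _ _ => isClosed_closure
  have hEsub : E ⊆ {η} ∪ F := fun z hz => by
    obtain ⟨η', hη'max, hη'z⟩ := exists_mem_maxPoints_specializes hE hz
    by_cases hη'η : η' = η
    · subst hη'η
      left
      exact hcl.closure_subset (specializes_iff_mem_closure.mp hη'z)
    · right
      exact Set.mem_biUnion (show η' ∈ excPoints π \ {η} from ⟨hη'max, hη'η⟩)
        (specializes_iff_mem_closure.mp hη'z)
  have hdisj : ∀ z ∈ E, z ∈ ({η} : Set X) → z ∈ F → False := by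
    rintro z - rfl hzF
    obtain ⟨η', hη', hzη'⟩ := Set.mem_iUnion₂.mp hzF
    have hsp : η' ⤳ z := specializes_iff_mem_closure.mpr hzη'
    exact hη'.2 (hηmax.2 η' hη'.1.1 hsp)
  have hEη : E ⊆ {η} := fun z hz => by
    rcases hEsub hz with h | h
    · exact h
    · exfalso
      have hne : (E ∩ {η}).Nonempty := ⟨η, hηexc.1, rfl⟩
      obtain ⟨w, hwE, hwη, hwF⟩ := (isPreconnected_closed_iff.mp (hπ.isPreconnected_closedFibre))
        {η} F hcl hF hEsub hne ⟨z, hz, h⟩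
      exact hdisj w hwE hwη hwF
  exact hπ.isRegularLocalRing_of_closedFibre_subsingleton
    (Set.subsingleton_singleton.anti hEη)

/-- **Purity of the closed fibre**: for a resolution `π : X → Spec T` of a two-dimensional
Noetherian local normal domain which is not regular, every maximal point of the closed fibre is an
integral exceptional curve point — `excPoints π ⊆ excCurvePoints π`, i.e. the closed fibre has no
isolated points (Lipman 1969 §10: the components of `C` correspond to its non-closed points).
[cite: Lipman1969, Section 10 (p. 212)] -/
theorem IsResolution.excPoints_subset_excCurvePoints [IsIntegrallyClosed T]
    (h2 : ringKrullDim T = 2) (hπ : IsResolution π) (hsing : ¬ IsRegularLocalRing T) :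
    excPoints π ⊆ excCurvePoints π := by
  intro η hη
  obtain ⟨η₀, hη₀, hη₀η⟩ :=
    hπ.exists_mem_excCurvePoints_specializes h2 hsing (base_eq_closedPoint_of_mem_excPoints hη)
  have : η₀ = η := hη.2 η₀ hη₀.1 hη₀η
  rwa [this] at hη₀

/-- **The two indexings of the exceptional curves agree** on a resolution of a two-dimensional
normal singularity: `excPoints π = excCurvePoints π` (Artin–Verdier's components of the closed
fibre = Lipman's integral exceptional curves). [cite: Lipman1969, Section 10 (p. 212)] -/
theorem IsResolution.excPoints_eq_excCurvePoints [IsIntegrallyClosed T]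
    (h2 : ringKrullDim T = 2) (hπ : IsResolution π) (hsing : ¬ IsRegularLocalRing T) :
    excPoints π = excCurvePoints π :=
  Set.Subset.antisymm (hπ.excPoints_subset_excCurvePoints h2 hsing)
    (hπ.excCurvePoints_subset_excPoints h2)

/-- **Maximal points of the closed fibre are codimension-one points** (resolution of a
two-dimensional normal singularity): every `η ∈ excPoints π` has `coheight η = 1`, so Mathlib's
`Scheme.ord _ η` is the valuation along the curve `E_η`. [cite: Lipman1969, Section 12 (p. 220)] -/
theorem IsResolution.coheight_eq_one_of_mem_excPoints [IsIntegrallyClosed T]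
    (h2 : ringKrullDim T = 2) (hπ : IsResolution π) (hsing : ¬ IsRegularLocalRing T) :
    ∀ η ∈ excPoints π, Order.coheight η = 1 := fun _ hη =>
  hπ.coheight_eq_one_of_mem_excCurvePoints h2 (hπ.excPoints_subset_excCurvePoints h2 hsing hη)

/-- **Converse dictionary**: on a resolution of a two-dimensional normal singularity, a point of
the closed fibre of coheight one (`dim 𝒪_{X,x} = 1`) is an integral exceptional curve point — a
closed point of the closed fibre has coheight `2`. (`x` lies under some `η ∈ excCurvePoints π`,
which has coheight `1`; a proper generisation would force `coheight x ≥ 2`.)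
[cite: Lipman1969, Section 12 (p. 220)] -/
theorem IsResolution.mem_excCurvePoints_of_coheight_eq_one [IsIntegrallyClosed T]
    (h2 : ringKrullDim T = 2) (hπ : IsResolution π) (hsing : ¬ IsRegularLocalRing T)
    {x : X} (hx : π.base x = closedPoint T) (h1 : Order.coheight x = 1) :
    x ∈ excCurvePoints π := by
  obtain ⟨η, hη, hηx⟩ := hπ.exists_mem_excCurvePoints_specializes h2 hsing hx
  by_cases hxη : x = η
  · rwa [hxη]
  · exfalso
    have hlt : x < η := lt_of_specializes_of_ne' hηx hxη
    have hle := Order.coheight_add_one_le hlt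
    rw [hπ.coheight_eq_one_of_mem_excCurvePoints h2 hη, h1] at hle
    exact absurd hle (by decide)

omit [IsDomain T] [IsNoetherianRing T] in
/-- A point of a quasi-compact scheme with no proper specialisation (`height x = 0` in the
specialisation order) is a closed point. [folklore] -/
private theorem isClosed_singleton_of_height_eq_zero [IsProper π] {x : X}
    (h0 : Order.height x = 0) :
    IsClosed ({x} : Set X) := by
  obtain ⟨c, hxc, hccl, -⟩ := exists_isClosed_specializes_of_isProper (π := π) x
  by_cases hcx : c = x
  · rwa [hcx] at hccl
  · exfalso
    have hlt : c < x := lt_of_specializes_of_ne' hxc hcx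
    have := Order.height_add_one_le hlt
    rw [h0] at this
    exact absurd this (by simp)

/-- **Closed-fibre points off the exceptional curves are closed points** (resolution of a
two-dimensional Noetherian local domain; no normality or singularity hypothesis): if `π x = 𝔪`
then `x ∈ excCurvePoints π` or `{x}` is closed (`height x ≤ 1` on the closed fibre).
[cite: Lipman1969, Section 12 (p. 220)] -/
theorem IsResolution.mem_excCurvePoints_or_isClosed (h2 : ringKrullDim T = 2)
    (hπ : IsResolution π) {x : X} (hx : π.base x = closedPoint T) :
    x ∈ excCurvePoints π ∨ IsClosed ({x} : Set X) := by
  haveI : IsProper π := hπ.isProper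
  have hle := hπ.height_le_one_of_base_eq_closedPoint h2 hx
  rcases eq_or_ne (Order.height x) 1 with h | h
  · exact Or.inl ⟨hx, h⟩
  · right
    have h0 : Order.height x = 0 := by
      have : Order.height x < 1 := lt_of_le_of_ne hle h
      exact Order.lt_one_iff.mp this
    exact isClosed_singleton_of_height_eq_zero (π := π) h0

/-- The same alternative with Artin–Verdier's indexing: a closed-fibre point is a maximal point
of the closed fibre or a closed point. [cite: Lipman1969, Section 10 (p. 212)] -/
theorem IsResolution.mem_excPoints_or_isClosed (h2 : ringKrullDim T = 2)
    (hπ : IsResolution π) {x : X} (hx : π.base x = closedPoint T) :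
    x ∈ excPoints π ∨ IsClosed ({x} : Set X) :=
  (hπ.mem_excCurvePoints_or_isClosed h2 hx).imp_left
    fun h => hπ.excCurvePoints_subset_excPoints h2 h

/-- **A resolution of a two-dimensional normal singularity has an exceptional curve**:
`excCurvePoints π` is non-empty when `T` is not regular (the closed fibre is non-empty — it
contains the closed points of `X` — and each of its points lies on an exceptional curve).
[cite: Lipman1969, Section 10 (p. 212)] -/
theorem IsResolution.excCurvePoints_nonempty [IsIntegrallyClosed T]
    (h2 : ringKrullDim T = 2) (hπ : IsResolution π) (hsing : ¬ IsRegularLocalRing T) :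
    (excCurvePoints π).Nonempty := by
  haveI : IsProper π := hπ.isProper
  haveI : IsIntegral X := hπ.isIntegral_source
  obtain ⟨x₀⟩ := (inferInstance : Nonempty X)
  obtain ⟨c, -, -, hc⟩ := exists_isClosed_specializes_of_isProper (π := π) x₀
  obtain ⟨η, hη, -⟩ := hπ.exists_mem_excCurvePoints_specializes h2 hsing hc
  exact ⟨η, hη⟩

end Resolution

end Literature.AlgebraicGeometry.Resolution

end
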